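import Mathlib
import HarnessLib
import Literature.Computability.AlgebraicComplexity.DiPatternExpressions
import Summits.ValiantsHypothesis.ValiantsHypothesis.Theorems.MonotoneRestorationOrbitRestorationQPPerNotNarrow

/-!
# Route MonotoneRestoration — asides `OrbitCompressionQP` (stmt-ValiantsHypothesis-18332) and
# `OrbitRestorationLinearVolumeQP` (stmt-18294): REYNOLDS qp-DESCENT IS FALSE — the permanent lies in the
# Reynolds image of the TREEWIDTH-ZERO one-sorted span

`Theorems/…OrbitCompressionQPReynoldsDescent.lean` proposed to attack the common VH-free residue of the two asides
(qp-DESCENT, alias S1c: a MATRIX-symmetric member of the one-sorted narrow span `U_c(n) = span{dihom_{D,n} :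
tw D ≤ (log₂ n + c)^c}` lies in the bipartite narrow span `W_{c'}(n)`) PATTERN BY PATTERN, through the stronger
**Reynolds qp-descent**: for every `c` some `c'` such that for every level `n` and every directed looped pattern `D`
of treewidth `≤ (log₂ n + c)^c` the Reynolds sum `Σ_{(σ,τ) ∈ Sym_n × Sym_n} dihom_{D,n}(x_{σ i, τ j})` lies in
`W_{c'}(n)` — and flagged it "not known to be true: it is stronger than descent".

THIS FILE REFUTES REYNOLDS qp-DESCENT UNCONDITIONALLY, already at `c = 0` (patterns of treewidth `≤ 1`; the witnesses
have treewidth `0`):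

* `diHomPoly_loopPattern` — the LOOP PATTERN with multiplicities `m : Fin k → ℕ` (vertex `j` carries `m j` loops, no
  other arcs) has `dihom = Π_j tr(X^{∘ m j})`, a product of DIAGONAL POWER SUMS `Σ_i x_ii^{m j}`; its simple graph is
  edgeless (`not_adj_loopPattern`), so `treewidth_loopPattern_le : tw ≤ 0`;
* `prod_X_diag_mem_span_loopPatterns` — by Newton's identities (Mathlib `MvPolynomial.mul_esymm_eq_sum`, characteristic
  `0`) the diagonal product `Π_i x_ii = e_n(x_11, …, x_nn)` is a `ℂ`-combination of such products, i.e. of the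
  `dihom` of loop patterns;
* `reynolds_prod_X_diag` — the Reynolds sum of `Π_i x_ii` is `n! · per_n`;
* ★ `perPoly_mem_of_reynolds_loopPatterns_mem` — hence: if the Reynolds sum of the `dihom` of EVERY loop pattern at
  level `n` lies in a subspace `W`, then `per_n ∈ W`;
* ★★ `not_reynoldsDescent` — **Reynolds qp-descent (the hypothesis `hR` of `ReynoldsDescent.qpDescent_of_reynoldsDescent`,
  verbatim) is FALSE**: with `c = 0` it would put every `per_n` in `W_{c'}(n)`, against
  `OrbitRestorationQPHomPolyClose.perPoly_not_mem_narrowSpan` (Dawar–Wilsenach 2025 Thm 7.1, proved in the tree);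
  `exists_loopPattern_reynolds_not_mem` — the failure located: for every `c'` some level `n` and some treewidth-`0`
  loop pattern whose Reynolds sum is NOT in `W_{c'}(n)`;
* ★ `perPoly_not_mem_diNarrowSpan_of_qpDescent` — the prediction S1c makes instead: under qp-descent the permanent is
  not even ONE-SORTEDLY narrow (`per_n ∉ U_c(n)` for some `n`, every `c`).

CONSEQUENCE FOR BOTH LINES (honest label).  The Reynolds image `R(U_0(n))` of the treewidth-zero one-sorted span already
contains the permanent, so NO pattern-by-pattern / Reynolds-averaging argument can prove descent: whatever truth S1c
has lives in the cancellations forced by `p ∈ U_c(n)` itself (`MatSym ∩ U_c(n)` versus `R(U_c(n))`), equivalently in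
the lifting / window faces (`…OrbitCompressionQPLift`, `…DescentWindow`).  S1c, the registered stubs of the two lines,
R1, the asides and VP ≠ VNP are NOT moved; nothing here is a named fact (def-free helper,
`--supports stmt-ValiantsHypothesis-18332`).

References: Dawar–Pago–Seppelt 2025 (arXiv:2502.06740) Remark p. 17, §7 p. 45; Dawar–Wilsenach 2025 Thm 7.1;
Macdonald, *Symmetric functions and Hall polynomials* I (2.11′) (Newton's identities).
-/

noncomputable section

open scoped Classical

-- `Summit.ValiantsHypothesis.ValiantsHypothesis.…` is the tree's single-conjunct layout (Sub = Summit).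
set_option linter.dupNamespace false

namespace Summit.ValiantsHypothesis.ValiantsHypothesis.Theorems

namespace ReynoldsDescentFalse

open Literature.Computability.AlgebraicComplexity MvPolynomial
open Literature.Combinatorics.SimpleGraph (treewidth treewidth_le_of_intervals treewidth_le_card_sub_one)

/-! ### Loop patterns -/

/-- The simple graph of a LOOP PATTERN (vertex `j` carries `m j` loops, nothing else) is edgeless. [folklore] -/
theorem not_adj_loopPattern {k : ℕ} (m : Fin k → ℕ) (u v : Fin k) :
    ¬ (SimpleGraph.fromRel fun a b : Fin k =>
        ∃ e ∈ (∑ j : Fin k, Multiset.replicate (m j) (j, j) : Multiset (Fin k × Fin k)),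
          a = e.1 ∧ b = e.2).Adj u v := by
  rw [SimpleGraph.fromRel_adj]
  rintro ⟨hne, h⟩
  have key : ∀ a b : Fin k, (∃ e ∈ (∑ j : Fin k, Multiset.replicate (m j) (j, j) :
      Multiset (Fin k × Fin k)), a = e.1 ∧ b = e.2) → a = b := by
    rintro a b ⟨e, he, rfl, rfl⟩
    obtain ⟨j, -, hj⟩ := Multiset.mem_sum.1 he
    rw [Multiset.eq_of_mem_replicate hj]
  rcases h with h | h
  · exact hne (key u v h)
  · exact hne (key v u h).symm

/-- A loop pattern has treewidth `0` (singleton bags along a path). [folklore] -/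
theorem treewidth_loopPattern_le {k : ℕ} (m : Fin k → ℕ) :
    treewidth (SimpleGraph.fromRel fun a b : Fin k =>
        ∃ e ∈ (∑ j : Fin k, Multiset.replicate (m j) (j, j) : Multiset (Fin k × Fin k)),
          a = e.1 ∧ b = e.2) ≤ 0 := by
  cases k with
  | zero => simpa using treewidth_le_card_sub_one (SimpleGraph.fromRel fun a b : Fin 0 =>
        ∃ e ∈ (∑ j : Fin 0, Multiset.replicate (m j) (j, j) : Multiset (Fin 0 × Fin 0)),
          a = e.1 ∧ b = e.2)
  | succ k =>
    refine treewidth_le_of_intervals _ (fun t : Fin (k + 1) => ({t} : Finset (Fin (k + 1))))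
      (fun u v huv => (not_adj_loopPattern m u v huv).elim) (fun v => ⟨v, Finset.mem_singleton_self v⟩)
      (fun v => ?_) (fun t => by simp)
    have : {t : Fin (k + 1) | v ∈ ({t} : Finset (Fin (k + 1)))} = {v} := by
      ext t
      simp [eq_comm]
    rw [this]
    exact Set.ordConnected_singleton

/-- **`dihom` of a loop pattern is a product of diagonal power sums**: `Σ_h Π_j x_{h j, h j}^{m j} =
Π_j Σ_i x_ii^{m j}`. [folklore] -/
theorem diHomPoly_loopPattern (n : ℕ) {k : ℕ} (m : Fin k → ℕ) :
    diHomPoly (∑ j : Fin k, Multiset.replicate (m j) (j, j) : Multiset (Fin k × Fin k)) n ℂ =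
      ∏ j : Fin k, ∑ i : Fin n, (X (i, i) : MvPolynomial (Fin n × Fin n) ℂ) ^ (m j) := by
  unfold diHomPoly
  have hprod : ∀ h : Fin k → Fin n,
      ((∑ j : Fin k, Multiset.replicate (m j) (j, j) : Multiset (Fin k × Fin k)).map
          fun e => (X (h e.1, h e.2) : MvPolynomial (Fin n × Fin n) ℂ)).prod =
        ∏ j : Fin k, (X (h j, h j) : MvPolynomial (Fin n × Fin n) ℂ) ^ (m j) := by
    intro h
    rw [show ((∑ j : Fin k, Multiset.replicate (m j) (j, j) : Multiset (Fin k × Fin k)).map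
          fun e => (X (h e.1, h e.2) : MvPolynomial (Fin n × Fin n) ℂ)) =
        ∑ j : Fin k, (Multiset.replicate (m j) (j, j)).map
          fun e => (X (h e.1, h e.2) : MvPolynomial (Fin n × Fin n) ℂ) from
      map_sum (Multiset.mapAddMonoidHom fun e : Fin k × Fin k =>
        (X (h e.1, h e.2) : MvPolynomial (Fin n × Fin n) ℂ)) _ _, Multiset.prod_sum]
    refine Finset.prod_congr rfl fun j _ => ?_
    rw [Multiset.map_replicate, Multiset.prod_replicate]
  simp_rw [hprod]
  rw [Finset.prod_univ_sum]
  simp only [Fintype.piFinset_univ]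

/-! ### Newton: the diagonal product is a combination of loop-pattern `dihom`s -/

/-- Elementary symmetric polynomials lie in the subalgebra generated by the power sums (characteristic `0`;
Newton's identities `k e_k = Σ_{i<k} ± e_i p_{k-i}`). [cite: Macdonald1995, I (2.11′)] -/
theorem esymm_mem_adjoin_psum (σ : Type) [Fintype σ] (k : ℕ) :
    MvPolynomial.esymm σ ℂ k ∈ Algebra.adjoin ℂ (Set.range (MvPolynomial.psum σ ℂ)) := by
  induction k using Nat.strong_induction_on with
  | _ k ih =>
    rcases Nat.eq_zero_or_pos k with rfl | hk
    · rw [MvPolynomial.esymm_zero]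
      exact Subalgebra.one_mem _
    · set A := Algebra.adjoin ℂ (Set.range (MvPolynomial.psum σ ℂ)) with hA
      have hNewton := MvPolynomial.mul_esymm_eq_sum σ ℂ k
      have hrhs : (k : MvPolynomial σ ℂ) * MvPolynomial.esymm σ ℂ k ∈ A := by
        rw [hNewton]
        refine Subalgebra.mul_mem _ (Subalgebra.pow_mem _ (Subalgebra.neg_mem _ (Subalgebra.one_mem _)) _)
          (Subalgebra.sum_mem _ fun a ha => ?_)
        refine Subalgebra.mul_mem _ (Subalgebra.mul_mem _
          (Subalgebra.pow_mem _ (Subalgebra.neg_mem _ (Subalgebra.one_mem _)) _)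
          (ih a.1 (Finset.mem_filter.1 ha).2)) (Algebra.subset_adjoin ⟨a.2, rfl⟩)
      have hkC : (k : MvPolynomial σ ℂ) = C (k : ℂ) := (map_natCast C k).symm
      have hk0 : (k : ℂ) ≠ 0 := Nat.cast_ne_zero.2 hk.ne'
      have : MvPolynomial.esymm σ ℂ k = C ((k : ℂ)⁻¹) * ((k : MvPolynomial σ ℂ) * MvPolynomial.esymm σ ℂ k) := by
        rw [hkC, ← mul_assoc, ← C_mul, inv_mul_cancel₀ hk0, C_1, one_mul]
      rw [this]
      refine Subalgebra.mul_mem _ ?_ hrhs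
      rw [← MvPolynomial.algebraMap_eq]
      exact Subalgebra.algebraMap_mem _ _

/-- The diagonal embedding `x_i ↦ x_ii` sends the power sum `p_m` to the diagonal power sum `Σ_i x_ii^m`.
[folklore] -/
theorem rename_diag_psum (n m : ℕ) :
    rename (fun i : Fin n => (i, i)) (MvPolynomial.psum (Fin n) ℂ m) =
      ∑ i : Fin n, (X (i, i) : MvPolynomial (Fin n × Fin n) ℂ) ^ m := by
  unfold MvPolynomial.psum
  rw [map_sum]
  simp only [map_pow, rename_X]

/-- The diagonal embedding sends `e_n(x_1, …, x_n)` to `Π_i x_ii`. [folklore] -/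
theorem rename_diag_esymm_self (n : ℕ) :
    rename (fun i : Fin n => (i, i)) (MvPolynomial.esymm (Fin n) ℂ n) =
      ∏ i : Fin n, (X (i, i) : MvPolynomial (Fin n × Fin n) ℂ) := by
  have h : MvPolynomial.esymm (Fin n) ℂ n = ∏ i : Fin n, (X i : MvPolynomial (Fin n) ℂ) := by
    unfold MvPolynomial.esymm
    have hps : Finset.powersetCard n (Finset.univ : Finset (Fin n)) = {Finset.univ} := by
      simpa using Finset.powersetCard_self (Finset.univ : Finset (Fin n))
    rw [hps, Finset.sum_singleton]
  rw [h, map_prod]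
  simp only [rename_X]

/-- Every element of the multiplicative closure of the diagonal power sums is a finite product of them,
indexed by some `Fin k`. [folklore] -/
theorem exists_prod_of_mem_closure (n : ℕ) {x : MvPolynomial (Fin n × Fin n) ℂ}
    (hx : x ∈ Submonoid.closure (Set.range fun m : ℕ =>
      ∑ i : Fin n, (X (i, i) : MvPolynomial (Fin n × Fin n) ℂ) ^ m)) :
    ∃ (k : ℕ) (m : Fin k → ℕ), x = ∏ j : Fin k, ∑ i : Fin n, (X (i, i) : MvPolynomial (Fin n × Fin n) ℂ) ^ (m j) := by
  induction hx using Submonoid.closure_induction with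
  | mem x h =>
    obtain ⟨m, rfl⟩ := h
    exact ⟨1, fun _ => m, by simp⟩
  | one => exact ⟨0, Fin.elim0, by simp⟩
  | mul x y _ _ ihx ihy =>
    obtain ⟨k₁, m₁, rfl⟩ := ihx
    obtain ⟨k₂, m₂, rfl⟩ := ihy
    refine ⟨k₁ + k₂, Fin.append m₁ m₂, ?_⟩
    rw [Fin.prod_univ_add]
    simp only [Fin.append_left, Fin.append_right]

/-- ★ **The diagonal product is a combination of loop-pattern homomorphism polynomials**: `Π_i x_ii` lies in
the `ℂ`-span of the `dihom_{D,n}` of loop patterns `D` (Newton's identities). [cite: Macdonald1995, I (2.11′)] -/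
theorem prod_X_diag_mem_span_loopPatterns (n : ℕ) :
    (∏ i : Fin n, (X (i, i) : MvPolynomial (Fin n × Fin n) ℂ)) ∈ Submodule.span ℂ
      {q : MvPolynomial (Fin n × Fin n) ℂ | ∃ (k : ℕ) (m : Fin k → ℕ),
        q = diHomPoly (∑ j : Fin k, Multiset.replicate (m j) (j, j) : Multiset (Fin k × Fin k)) n ℂ} := by
  set d : MvPolynomial (Fin n) ℂ →ₐ[ℂ] MvPolynomial (Fin n × Fin n) ℂ := rename fun i : Fin n => (i, i) with hd
  set T : Set (MvPolynomial (Fin n × Fin n) ℂ) :=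
    Set.range fun m : ℕ => ∑ i : Fin n, (X (i, i) : MvPolynomial (Fin n × Fin n) ℂ) ^ m with hT
  -- `Π x_ii = d (e_n) ∈ d (adjoin psum) ⊆ adjoin T`
  have hmemA : (∏ i : Fin n, (X (i, i) : MvPolynomial (Fin n × Fin n) ℂ)) ∈ Algebra.adjoin ℂ T := by
    rw [← rename_diag_esymm_self n]
    have h1 : d (MvPolynomial.esymm (Fin n) ℂ n) ∈
        (Algebra.adjoin ℂ (Set.range (MvPolynomial.psum (Fin n) ℂ))).map d :=
      Subalgebra.mem_map.2 ⟨_, esymm_mem_adjoin_psum (Fin n) n, rfl⟩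
    rw [← Algebra.adjoin_image] at h1
    refine Algebra.adjoin_mono ?_ h1
    rintro _ ⟨_, ⟨m, rfl⟩, rfl⟩
    exact ⟨m, (rename_diag_psum n m).symm⟩
  -- `adjoin T = span (closure T)`, and the closure consists of finite products
  have hspan : (∏ i : Fin n, (X (i, i) : MvPolynomial (Fin n × Fin n) ℂ)) ∈
      Submodule.span ℂ (Submonoid.closure T : Set (MvPolynomial (Fin n × Fin n) ℂ)) := by
    rw [← Algebra.adjoin_eq_span]
    exact hmemA
  refine Submodule.span_le.2 ?_ hspan
  intro x hx
  obtain ⟨k, m, rfl⟩ := exists_prod_of_mem_closure n hx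
  refine Submodule.subset_span ⟨k, m, ?_⟩
  rw [diHomPoly_loopPattern]

/-! ### The Reynolds sum of the diagonal product is `n! · per_n` -/

/-- **Reynolds sum of the diagonal product**: `Σ_{(σ,τ)} Π_i x_{σ i, τ i} = n! · per_n`. [folklore] -/
theorem reynolds_prod_X_diag (n : ℕ) :
    (∑ g : Equiv.Perm (Fin n) × Equiv.Perm (Fin n),
        rename (fun ij : Fin n × Fin n => (g.1 ij.1, g.2 ij.2))
          (∏ i : Fin n, (X (i, i) : MvPolynomial (Fin n × Fin n) ℂ))) =
      ((Nat.factorial n : ℕ) : ℂ) • perPoly (Fin n) ℂ := by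
  have hper : perPoly (Fin n) ℂ = ∑ π : Equiv.Perm (Fin n), ∏ i : Fin n,
      (X (π i, i) : MvPolynomial (Fin n × Fin n) ℂ) := by
    unfold perPoly Matrix.permanent
    simp only [Matrix.mvPolynomialX_apply]
  simp only [map_prod, rename_X]
  rw [Fintype.sum_prod_type]
  -- reindex the product by `j = τ i`, then the inner sum by `π = σ τ⁻¹`
  have hinner : ∀ σ τ : Equiv.Perm (Fin n),
      (∏ i : Fin n, (X (σ i, τ i) : MvPolynomial (Fin n × Fin n) ℂ)) =
        ∏ j : Fin n, (X ((σ * τ⁻¹) j, j) : MvPolynomial (Fin n × Fin n) ℂ) := by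
    intro σ τ
    exact Fintype.prod_equiv τ _ _ fun i => by simp [Equiv.Perm.mul_apply]
  simp_rw [hinner]
  rw [Finset.sum_comm]
  have hσ : ∀ τ : Equiv.Perm (Fin n),
      (∑ σ : Equiv.Perm (Fin n), ∏ j : Fin n, (X ((σ * τ⁻¹) j, j) : MvPolynomial (Fin n × Fin n) ℂ)) =
        ∑ π : Equiv.Perm (Fin n), ∏ j : Fin n, (X (π j, j) : MvPolynomial (Fin n × Fin n) ℂ) :=
    fun τ => Fintype.sum_equiv (Equiv.mulRight τ⁻¹) _ _ fun σ => rfl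
  simp_rw [hσ]
  rw [Finset.sum_const, Finset.card_univ, Fintype.card_perm, Fintype.card_fin, ← hper, Nat.cast_smul_eq_nsmul]

/-- ★ **If the Reynolds sum of the `dihom` of every loop pattern at level `n` lies in a subspace `W`, then
`per_n ∈ W`.** [folklore] -/
theorem perPoly_mem_of_reynolds_loopPatterns_mem (n : ℕ) (W : Submodule ℂ (MvPolynomial (Fin n × Fin n) ℂ))
    (hW : ∀ (k : ℕ) (m : Fin k → ℕ),
      (∑ g : Equiv.Perm (Fin n) × Equiv.Perm (Fin n),
        rename (fun ij : Fin n × Fin n => (g.1 ij.1, g.2 ij.2))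
          (diHomPoly (∑ j : Fin k, Multiset.replicate (m j) (j, j) : Multiset (Fin k × Fin k)) n ℂ)) ∈ W) :
    perPoly (Fin n) ℂ ∈ W := by
  -- the Reynolds sum as a linear map
  set RS : MvPolynomial (Fin n × Fin n) ℂ →ₗ[ℂ] MvPolynomial (Fin n × Fin n) ℂ :=
    ∑ g : Equiv.Perm (Fin n) × Equiv.Perm (Fin n),
      (rename (fun ij : Fin n × Fin n => (g.1 ij.1, g.2 ij.2)) :
        MvPolynomial (Fin n × Fin n) ℂ →ₐ[ℂ] MvPolynomial (Fin n × Fin n) ℂ).toLinearMap with hRS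
  have hRS_apply : ∀ p : MvPolynomial (Fin n × Fin n) ℂ, RS p =
      ∑ g : Equiv.Perm (Fin n) × Equiv.Perm (Fin n),
        rename (fun ij : Fin n × Fin n => (g.1 ij.1, g.2 ij.2)) p := by
    intro p
    simp [hRS, LinearMap.sum_apply]
  have hle : Submodule.span ℂ
      {q : MvPolynomial (Fin n × Fin n) ℂ | ∃ (k : ℕ) (m : Fin k → ℕ),
        q = diHomPoly (∑ j : Fin k, Multiset.replicate (m j) (j, j) : Multiset (Fin k × Fin k)) n ℂ} ≤
      W.comap RS := by
    refine Submodule.span_le.2 ?_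
    rintro q ⟨k, m, rfl⟩
    show RS _ ∈ W
    rw [hRS_apply]
    exact hW k m
  have hmem := hle (prod_X_diag_mem_span_loopPatterns n)
  rw [Submodule.mem_comap, hRS_apply, reynolds_prod_X_diag] at hmem
  exact (Submodule.smul_mem_iff W (Nat.cast_ne_zero.2 (Nat.factorial_ne_zero n))).1 hmem

/-! ### Reynolds qp-descent is false -/

/-- ★★ **REYNOLDS qp-DESCENT IS FALSE** (the hypothesis `hR` of `ReynoldsDescent.qpDescent_of_reynoldsDescent`,
verbatim, negated): already for `c = 0` (patterns of treewidth `≤ 1`) no `c'` works, because the loop patterns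
(treewidth `0`) would put every permanent `per_n` in the bipartite narrow span of width `(log₂ n + c')^{c'}`,
contradicting `perPoly_not_mem_narrowSpan` (Dawar–Wilsenach 2025 Thm 7.1 in the tree).
[cite: DawarWilsenach2025, Thm. 7.1 (p. 18)] -/
theorem not_reynoldsDescent :
    ¬ ∀ c : ℕ, ∃ c' : ℕ, ∀ (n a : ℕ) (D : Multiset (Fin a × Fin a)),
      treewidth (SimpleGraph.fromRel fun u v : Fin a => ∃ e ∈ D, u = e.1 ∧ v = e.2) ≤
        (Nat.log 2 n + c) ^ c →
      (∑ g : Equiv.Perm (Fin n) × Equiv.Perm (Fin n),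
          rename (fun ij : Fin n × Fin n => (g.1 ij.1, g.2 ij.2)) (diHomPoly D n ℂ)) ∈
        Submodule.span ℂ {q : MvPolynomial (Fin n × Fin n) ℂ | ∃ (a' b' : ℕ) (F : Multiset (Fin a' × Fin b')),
          treewidth (SimpleGraph.fromRel fun u v : Fin a' ⊕ Fin b' =>
              ∃ e ∈ F, u = Sum.inl e.1 ∧ v = Sum.inr e.2) ≤ (Nat.log 2 n + c') ^ c' ∧ q = homPoly F n ℂ} := by
  intro hR
  obtain ⟨c', hc'⟩ := hR 0
  refine OrbitRestorationQPHomPolyClose.perPoly_not_mem_narrowSpan c' fun n => ?_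
  refine perPoly_mem_of_reynolds_loopPatterns_mem n _ fun k m => hc' n k _ ?_
  rw [pow_zero]
  exact (treewidth_loopPattern_le m).trans zero_le_one

/-- **The failure located**: for every `c'` there are a level `n` and a loop pattern (treewidth `0`, a product
of diagonal power sums) whose Reynolds sum is NOT in the bipartite narrow span of width `(log₂ n + c')^{c'}`.
[cite: DawarWilsenach2025, Thm. 7.1 (p. 18)] -/
theorem exists_loopPattern_reynolds_not_mem (c' : ℕ) :
    ∃ (n k : ℕ) (m : Fin k → ℕ),
      (∑ g : Equiv.Perm (Fin n) × Equiv.Perm (Fin n),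
          rename (fun ij : Fin n × Fin n => (g.1 ij.1, g.2 ij.2))
            (diHomPoly (∑ j : Fin k, Multiset.replicate (m j) (j, j) : Multiset (Fin k × Fin k)) n ℂ)) ∉
        Submodule.span ℂ {q : MvPolynomial (Fin n × Fin n) ℂ | ∃ (a' b' : ℕ) (F : Multiset (Fin a' × Fin b')),
          treewidth (SimpleGraph.fromRel fun u v : Fin a' ⊕ Fin b' =>
              ∃ e ∈ F, u = Sum.inl e.1 ∧ v = Sum.inr e.2) ≤ (Nat.log 2 n + c') ^ c' ∧ q = homPoly F n ℂ} := by
  by_contra h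
  refine OrbitRestorationQPHomPolyClose.perPoly_not_mem_narrowSpan c' fun n =>
    perPoly_mem_of_reynolds_loopPatterns_mem n _ fun k m => ?_
  by_contra hkm
  exact h ⟨n, k, m, hkm⟩

/-! ### What qp-descent predicts instead: the permanent is not one-sortedly narrow -/

/-- ★ **Under qp-DESCENT the permanent is not ONE-SORTEDLY narrow**: if every matrix-symmetric member of
`U_c(n)` lies in `W_{c'}(n)` (qp-descent, S1c in its span face, all degrees), then for every `c` some `per_n`
lies outside the one-sorted narrow span `U_c(n)` (the permanent is matrix-symmetric, and narrow bipartitely for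
no `c'`).  A consistency test for S1c: an unconditional proof of this conclusion is the natural next calibration.
[cite: DawarWilsenach2025, Thm. 7.1 (p. 18)] -/
theorem perPoly_not_mem_diNarrowSpan_of_qpDescent
    (hdesc : ∀ c : ℕ, ∃ c' : ℕ, ∀ (n : ℕ) (p : MvPolynomial (Fin n × Fin n) ℂ),
      (∀ σ τ : Equiv.Perm (Fin n), rename (fun ij : Fin n × Fin n => (σ ij.1, τ ij.2)) p = p) →
      p ∈ Submodule.span ℂ {q : MvPolynomial (Fin n × Fin n) ℂ |
        ∃ (a : ℕ) (D : Multiset (Fin a × Fin a)),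
          treewidth (SimpleGraph.fromRel fun u v : Fin a => ∃ e ∈ D, u = e.1 ∧ v = e.2) ≤
            (Nat.log 2 n + c) ^ c ∧ q = diHomPoly D n ℂ} →
      p ∈ Submodule.span ℂ {q : MvPolynomial (Fin n × Fin n) ℂ | ∃ (a b : ℕ) (F : Multiset (Fin a × Fin b)),
        treewidth (SimpleGraph.fromRel fun u v : Fin a ⊕ Fin b =>
            ∃ e ∈ F, u = Sum.inl e.1 ∧ v = Sum.inr e.2) ≤ (Nat.log 2 n + c') ^ c' ∧ q = homPoly F n ℂ})
    (c : ℕ) :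
    ¬ ∀ n : ℕ, perPoly (Fin n) ℂ ∈ Submodule.span ℂ {q : MvPolynomial (Fin n × Fin n) ℂ |
        ∃ (a : ℕ) (D : Multiset (Fin a × Fin a)),
          treewidth (SimpleGraph.fromRel fun u v : Fin a => ∃ e ∈ D, u = e.1 ∧ v = e.2) ≤
            (Nat.log 2 n + c) ^ c ∧ q = diHomPoly D n ℂ} := by
  intro h
  obtain ⟨c', hc'⟩ := hdesc c
  have hsymm : ∀ (n : ℕ) (σ τ : Equiv.Perm (Fin n)),
      rename (fun p : Fin n × Fin n => (σ p.1, τ p.2)) (perPoly (Fin n) ℂ) = perPoly (Fin n) ℂ := by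
    intro n σ τ
    have h' := congrArg (MvPolynomial.map (Complex.ofRealHom.comp NNReal.toRealHom))
      (MonotoneRestorationQP.Negative.rename_perm_perPoly n σ τ)
    rw [MvPolynomial.map_rename, map_perPoly] at h'
    exact h'
  exact OrbitRestorationQPHomPolyClose.perPoly_not_mem_narrowSpan c' fun n => hc' n _ (hsymm n) (h n)

end ReynoldsDescentFalse

end Summit.ValiantsHypothesis.ValiantsHypothesis.Theorems

end
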